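import Summits.QuantumFields.BalabanUV.T4Continuum.Support.NE2FromNE3Carrier
import Summits.QuantumFields.BalabanUV.T4Continuum.Spine.NE2BalabanThreshold
import Summits.QuantumFields.BalabanUV.T4Continuum.Spine.NE2BalabanFlatWitness
import Summits.QuantumFields.BalabanUV.T4Continuum.Support.MinimalActionRate
import Summits.QuantumFields.BalabanUV.T4Continuum.Spine.NE3.LeafIndex

/-!
# T⁴ programme, spine node NE2 (U1a), tier B — ROOT B's `hNE3` ON NODE NE3's OWN LANDED CARRIER `MinimalActionRate.minActReadings`
# BY NAME (referee condition c7 of `t4/formal/NE2/REFEREE.md`: the DAG edge NE2(tier B) ⇐ NE3, by name on both ends)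

NE2 formalisation swarm `b2b-balaban-t4-ne2-formalise-*`, leaf prover 08 (gen 2; row B7's lineage), leaf-proposed SUPPORT row «B6′ c7-adapter»,
module 2 of 2 (module 1: `Support/NE2FromNE3Carrier`).  Inputs BY NAME: `Spine/NE2BalabanThreshold.balaban_final_rate_of_regular` (ROOT B's `t = 1`
face, leaf-08), `Support/MinimalActionRate.minActReadings` (the NE3 lineage's readings carrier, owner t4-ne3-p1), `Support/NE2FromNE3Carrier`
(`ne2Loc`, `localRate_iff_forall_regClass`), `Support/NE2FromNE3.bgReadings` (row B6), `Support/RegularBackgroundTower.{RegularTransporters, regClass}`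
(row B5), `T4EtaRateMin.{LocalRate, ActionRate, NE3Shape}` (node U1b's shapes), `Spine/NE3/LeafIndex.{RootA, ne3Shape_minAct_iff}` (NE3 swarm typer),
`Spine/NE2BalabanFlatWitness.localRate_flat` (leaf-03).

THE POINT.  The NE3 lineage's carrier `minActReadings d 𝒞 L N dom loc : T4EtaRateMin.Readings (Site d → Fin d → (Matrix o o ℂ)ˣ) X` (data = unit-lattice
configurations `V`, `act k V` = the minimal level-`k` action, `vol = N^d`) takes its LOCAL READING `loc` AS A PARAMETER SUPPLIED BY THE CONSUMER (its
docstring: the local half of `NE3Shape`, readings (D)/(F), «is a separate obligation about whatever `loc` a consumer supplies»).  ROOT B is that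
consumer: with `loc := ne2Loc L M Rt` — at the site `(b, s)`, the NE2 entry-reading of the connection tower `w(Rt V)` (`b = true`) or of its lattice
derivative `D_νw_ν(Rt V)` (`b = false`) of the datum's background tower `Rt V` —
 * §1 **`localRate_minActReadings_iff`**: `LocalRate (minActReadings d 𝒞 L N dom (ne2Loc L M Rt)) C θ ↔ ∀ V ∈ dom, LocalRate (bgReadings L M
   (regClass L M (Rt V))) C θ` — node U1b's LOCAL half on NE3's carrier IS ROOT B's binder `hNE3` for every admissible datum (faithful both ways);
   `ne3Shape_minActReadings_iff` splits `NE3Shape` on that carrier into rate honesty ∧ NE3-(A)'s `ActionRate` (the NE3 swarm's ROOT-A, by name) ∧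
   ROOT B's `hNE3` for all `V ∈ dom`; `localRate_regClass_of_minActReadings` adds the rate monotonicity `θ ≤ L⁻¹`.
 * §2 **`balaban_final_rate_of_minActReadings`** / **`balaban_final_rate_of_ne3Shape`**: ROOT B's `t = 1` conclusion
   (`NE2BalabanThreshold.balaban_final_rate_of_regular`, VERBATIM) for the background `Rg V` of EVERY admissible datum `V`, displaying
   `hNE3 : LocalRate (minActReadings d 𝒞 L N dom (ne2Loc L M (liftR ∘ Rg))) C θ` (resp. `NE3Shape …`) with `0 ≤ C`, `0 ≤ θ ≤ L⁻¹`, row B5's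
   `hreg` for `Rg V`, `0 < a′`, `α, β ≤ η ≤ η⋆`; `balaban_final_rate_of_ne3Shape_sq` is the face at NE3-(A)'s rate `θ = (L²)⁻¹`.
 * §4 NON-VACUITY of the displayed binder on NE3's carrier: with the flat family `Rg ≡ 1` for every datum, `localRate_minActReadings_flat` —
   `LocalRate (minActReadings d 𝒞 L N dom (ne2Loc L M fun _ => liftR L M oneR)) C θ` for all `C, θ ≥ 0` (leaf-03's `NE2BalabanFlatWitness.localRate_flat` BY
   NAME through §1) — the adapter's hypothesis is inhabited (says nothing about non-flat data).
 * §3 JUNCTION WITH THE NE3 SWARM's LEAF INDEX (`Spine/NE3/LeafIndex`, typer t4-ne3-formalise-typer): **`ne3Shape_iff_rootA_and_rootB`** — at the wall's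
   constant `wallConstNA d L·(g + b³)/L²` and rate `(L²)⁻¹`, `NE3Shape` on NE3's carrier with the NE2 reading = rate honesty ∧ `NE3.LeafIndex.RootA d 𝒞 L N b g dom
   (ne2Loc L M Rt)` (the NE3 swarm's typed ROOT-A, BY NAME) ∧ ROOT B's `hNE3` for every `V ∈ dom` (`NE3.LeafIndex.ne3Shape_minAct_iff` + §1).
So the edge NE2(tier B) ⇐ NE3 is BY NAME ON BOTH ENDS: ROOT B consumes `T4EtaRateMin.LocalRate`/`NE3Shape` on `MinimalActionRate.minActReadings`.
WHAT IS LEFT OF c7 (stated, not hidden): (i) the NE3 tree inhabits NO local half today — route (A) is the ACTION half (`actionRate_of_sandwichData`),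
and the co-owners' energy-distance road (readings (D)/(F): `NE3EnergyShapes.NE3EnergyRate`, p212884, END `NE3EnergyAssembly.ne3EnergyRate_of_routeLeaves`,
both IN the tree — v1 of this header wrongly said «not in the tree») is typed in an ℓ²-ENERGY currency (`energyNorm` of the un-scaled log-direction `Z`
between `U_k^u` and the block average of `U_{k+1}`, `≤ C·residualScale(k)`), NOT the per-bond SUP consistency of the connection towers at rate `L⁻¹` that
`hNE3` is: located and typed as GAPS G-ne2leaf08g2-1 — (M1) ℓ² → sup needs the (3.35) Lipschitz data of both fields and then yields only the slower
geometric rate `L^{−kd/(d+2)}` (`L^{−2k/3}` for d = 4) while ROOT B's files are hard-wired to `L⁻¹`, (M2) block average vs parent-bond reading (bridgeable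
in row B5's shapes), (M3) the per-level gauge `u` of the energy statement is unconstrained; so a further bridge «energy distance of the two runs' minimisers
⇒ `LocalRate (minActReadings … (ne2Loc L M Rg))` for the transporter tower `Rg` of record» is owed (ROOT B at a general rate `ρ`, an interpolation lemma,
an inter-level gauge statement) by whoever identifies `Rg V` with the (3.35)-gauge transporters of `U_k(V)` (the B0-adjacent reading, outside this
model-level file, trigger c5); (ii) the owner lineages' word that `ne2Loc` (gauge-fixed transporter entries at block-addressed sites = reading (F)
«fields at King-corresponding bonds») is an admissible local reading for node U1b — the carrier was built to let the consumer choose it.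

HONEST FRAMING (T4-DAG p. 1).  Bookkeeping: one `Iff` by unfolding + one composition BY NAME; `Rg : V ↦ (k ↦ R_k)` is DATA (no assertion that
`Rg V` is (3.35)'s transporter tower of Bałaban's minimiser `U_k(V)` — no B0, trigger c5); NOTHING of node NE3 is proved — the displayed
`LocalRate (minActReadings … (ne2Loc …)) C θ` is node U1b's local half for this reading, OPEN (the NE3 tree inhabits the ACTION half only, and
that conditionally); ROOT B stays CONDITIONAL on it + row B5's (3.35)-shape class + `η ≤ η⋆`; MODEL LEVEL, GLOBAL small field, finite torus,
linear layer, operator norm; NOT [B9] (3.23)–(3.26) as printed; NE2 (U1a) NOT proved (c1 with the carver); spine PROVED 0/9 unchanged; NOT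
infinite volume / mass gap / Clay.  HONEST DEPENDENCY: continuum YM on T⁴ ⇐ BetaPertH ∧ nine spine estimates (0/9 proved); BetaPertH ⇐ (D1) ∧
(D4) ∧ CAP+tail; G-an2-4 gates asym, D1 and NE2/3/4.  ABSOLUTE RULE kept; no `def … : Prop` fact; no new definition; no `sorry`.
-/

noncomputable section

open scoped BigOperators ComplexConjugate Matrix Matrix.Norms.L2Operator Kronecker

namespace Summit.QuantumFields.BalabanUV.T4Continuum.NE2BalabanFromNE3

open Literature.MathematicalPhysics.QuantumFieldTheory.Balaban1983to89
open Literature.MathematicalPhysics.QuantumFieldTheory.Balaban1983to89.B5Prop11Plancherel (Cst Tor fine)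
open Literature.MathematicalPhysics.QuantumFieldTheory.Balaban1983to89.B5G183RateUnitTower (lev lev_neZero)
open Literature.MathematicalPhysics.QuantumFieldTheory.Balaban1983to89.T4EtaRateMin (Readings LocalRate ActionRate NE3Shape)
open Summit.QuantumFields.BalabanUV.T4Continuum
open Summit.QuantumFields.BalabanUV.T4Continuum.CovariantAveragingTower (TowerLimitRate)
open Summit.QuantumFields.BalabanUV.T4Continuum.BalabanAveragedTowerUnit (idx Qlev)
open Summit.QuantumFields.BalabanUV.T4Continuum.BackgroundResolventTower
open Summit.QuantumFields.BalabanUV.T4Continuum.KingPairingPlantedLaw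
open Summit.QuantumFields.BalabanUV.T4Continuum.GramPerturbationLaw (C2gram)
open Summit.QuantumFields.BalabanUV.T4Continuum.NE2FromNE3 (Site bgReadings)
open Summit.QuantumFields.BalabanUV.T4Continuum.NE2FromNE3Carrier (ne2Loc localRate_iff_forall_regClass localRate_regClass_of_localRate_lev)
open Summit.QuantumFields.BalabanUV.T4Continuum.RegularBackgroundTower (RegularTransporters regClass betaNE3)
open Summit.QuantumFields.BalabanUV.T4Continuum.GaugeTermScalarData (QuT Q1)
open Summit.QuantumFields.BalabanUV.T4Continuum.RegularSiteTransporters (siteT)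
open Summit.QuantumFields.BalabanUV.T4Continuum.NestedContourTransport (theta0)
open Summit.QuantumFields.BalabanUV.T4Continuum.NE2BalabanRoot (balabanPert)
open Summit.QuantumFields.BalabanUV.T4Continuum.NE2BalabanGauge (gaugeSlot liftR)
open Summit.QuantumFields.BalabanUV.T4Continuum.NE2BalabanLayerSharp (kappaBs C2Bs)
open Summit.QuantumFields.BalabanUV.T4Continuum.NE2BalabanWiring (epsR CdeltaR)
open Summit.QuantumFields.BalabanUV.T4Continuum.NE2BalabanFinal (kappa4F C4F)
open Summit.QuantumFields.BalabanUV.T4Continuum.NE2BalabanThreshold (etaStar balaban_final_rate_of_regular)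
open Summit.QuantumFields.BalabanUV.T4Continuum.GaugeTermPerturbationLaw (oneR)
open Summit.QuantumFields.BalabanUV.T4Continuum.MinimalActionRate (minActReadings)
open Literature.MathematicalPhysics.QuantumFieldTheory.Balaban1983to89.T4AveragingDeficitNonAbelian (wallConstNA)

variable {d : ℕ} (L : ℕ) [NeZero L] (M : Fin d → ℕ) [hM : ∀ μ, NeZero (M μ)] (a : ℝ) (ha : 0 < a)
variable {o : Type*} [Fintype o] [DecidableEq o]

/-! ## §1 Node U1b's local half on NE3's carrier with the NE2 reading IS ROOT B's `hNE3`, datum by datum -/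

section Carrier

variable {𝒞 : ℕ → Set (B7Prop1Explicit.Site d → Fin d → (Matrix o o ℂ)ˣ)} {N : ℕ}
  {dom : Set (B7Prop1Explicit.Site d → Fin d → (Matrix o o ℂ)ˣ)}
  {Rt : (B7Prop1Explicit.Site d → Fin d → (Matrix o o ℂ)ˣ) → ((k : ℕ) → Fin d → (idx L M k → Matrix o o ℂ))} {C θ : ℝ}

omit [NeZero L] hM in
/-- NE3's carrier with the NE2 reading: admissible data and local reading, unfolded (`rfl`). [folklore] -/
theorem minActReadings_ne2Loc_loc :
    (minActReadings d 𝒞 L N dom (ne2Loc L M Rt)).dom = dom ∧ (minActReadings d 𝒞 L N dom (ne2Loc L M Rt)).loc = ne2Loc L M Rt :=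
  ⟨rfl, rfl⟩

omit [NeZero L] hM in
/-- **THE c7 ADAPTER ON NODE NE3's OWN CARRIER**: node U1b's `LocalRate` on `MinimalActionRate.minActReadings d 𝒞 L N dom (ne2Loc L M Rt)` — the
NE3 lineage's readings of the two runs' minimisers, with the consumer-supplied local reading `ne2Loc L M Rt` — holds with constants `(C, θ)` IFF
ROOT B's binder `LocalRate (bgReadings L M (regClass L M (Rt V))) C θ` holds for EVERY admissible datum `V ∈ dom`. [folklore] -/
theorem localRate_minActReadings_iff :
    LocalRate (minActReadings d 𝒞 L N dom (ne2Loc L M Rt)) C θ ↔ ∀ V ∈ dom, LocalRate (bgReadings L M (regClass L M (Rt V))) C θ :=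
  localRate_iff_forall_regClass L M (minActReadings d 𝒞 L N dom (ne2Loc L M Rt)) Rt rfl

omit [NeZero L] hM in
/-- `NE3Shape` on that carrier = rate honesty ∧ NE3-(A)'s `ActionRate` (the NE3 swarm's ROOT-A target, by name) ∧ ROOT B's `hNE3` for every
admissible datum. [folklore] -/
theorem ne3Shape_minActReadings_iff :
    NE3Shape (minActReadings d 𝒞 L N dom (ne2Loc L M Rt)) C θ ↔
      (0 ≤ θ ∧ θ < 1) ∧ ActionRate (minActReadings d 𝒞 L N dom (ne2Loc L M Rt)) C θ
        ∧ ∀ V ∈ dom, LocalRate (bgReadings L M (regClass L M (Rt V))) C θ :=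
  ⟨fun h => ⟨⟨h.rate_nonneg, h.rate_lt_one⟩, h.action, (localRate_minActReadings_iff L M).1 h.pointwise⟩,
    fun h => ⟨h.1.1, h.1.2, h.2.1, (localRate_minActReadings_iff L M).2 h.2.2⟩⟩

omit [NeZero L] hM in
/-- **ROOT B's `hNE3` FOR THE DATUM `V`, from node U1b's local half on NE3's carrier** (rates `0 ≤ θ ≤ L⁻¹`, e.g. NE3-(A)'s `(L²)⁻¹`; `0 ≤ C`).
[folklore] -/
theorem localRate_regClass_of_minActReadings (hC : 0 ≤ C) (hθ0 : 0 ≤ θ) (hθL : θ ≤ (L : ℝ)⁻¹)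
    (h : LocalRate (minActReadings d 𝒞 L N dom (ne2Loc L M Rt)) C θ) {V : B7Prop1Explicit.Site d → Fin d → (Matrix o o ℂ)ˣ} (hV : V ∈ dom) :
    LocalRate (bgReadings L M (regClass L M (Rt V))) C ((L : ℝ)⁻¹) :=
  localRate_regClass_of_localRate_lev L M (R := minActReadings d 𝒞 L N dom (ne2Loc L M Rt)) rfl hC hθ0 hθL h hV

end Carrier

/-! ## §2 ROOT B at `t = 1` for every admissible datum, displaying node U1b's shape on NE3's carrier -/

section RootB

variable {𝒞 : ℕ → Set (B7Prop1Explicit.Site d → Fin d → (Matrix o o ℂ)ˣ)} {N : ℕ}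
  {dom : Set (B7Prop1Explicit.Site d → Fin d → (Matrix o o ℂ)ˣ)}
  {Rg : (B7Prop1Explicit.Site d → Fin d → (Matrix o o ℂ)ˣ) → ((k : ℕ) → Fin d → (Tor (fine (lev L k) M) → Matrix o o ℂ))}

/-- **ROOT B AT `t = 1` FOR THE BACKGROUND OF EVERY ADMISSIBLE DATUM, `hNE3` ON NODE NE3's CARRIER** (`L ≥ 2`, `d ≥ 1`, `a′ > 0`): if the NE3
lineage's readings `minActReadings d 𝒞 L N dom (ne2Loc L M (liftR ∘ Rg))` — local reading = the NE2 entries of `{w, D_νw_ν}` of the datum's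
site-based transporter tower `Rg V` (DATA) — satisfy node U1b's `LocalRate … C θ` with `0 ≤ C`, `0 ≤ θ ≤ L⁻¹` (OPEN; displayed), then for every
`V ∈ dom` whose tower lies in row B5's (3.35)-shape class with sizes `α, β ≤ η ≤ η⋆(card o, d, a, a′)`, the lifted King-averaged unit-lattice
covariances of `(Δ_a^{(k)} ⊗ 1 + P_k(Rg V))⁻¹` CONVERGE with rate `L^{−k}` — `NE2BalabanThreshold.balaban_final_rate_of_regular` VERBATIM for `Rg V`.
Model level (no B0); NOT [B9] (3.23)–(3.26) as printed; NE2 (U1a) NOT proved; node NE3 NOT proved.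
[cite: Balaban1985BackgroundPropagators, (3.26) p.395, (3.35) p.396 (shapes)] [folklore] -/
theorem balaban_final_rate_of_minActReadings (hL : 2 ≤ L) (hd : 1 ≤ d) {C θ : ℝ} (hC : 0 ≤ C) (hθ0 : 0 ≤ θ) (hθL : θ ≤ (L : ℝ)⁻¹)
    (hNE3 : LocalRate (minActReadings d 𝒞 L N dom (ne2Loc L M fun V => liftR L M (Rg V))) C θ)
    {V : B7Prop1Explicit.Site d → Fin d → (Matrix o o ℂ)ˣ} (hV : V ∈ dom)
    {α β : ℝ} (hreg : RegularTransporters L M (liftR L M (Rg V)) α β) {a' : ℝ} (ha' : 0 < a')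
    {η : ℝ} (hαη : α ≤ η) (hβη : β ≤ η) (hη : η ≤ etaStar o d a a') :
    TowerLimitRate (fun k => Qlev L M k ⊗ₖ (1 : Matrix o o ℂ)) ((L : ℝ) ^ d)
      (fun k => (calDalev L M a ha k ⊗ₖ (1 : Matrix o o ℂ)
        + balabanPert L M a (liftR L M (Rg V)) (gaugeSlot L M (Rg V) (QuT L M o (siteT L M (Rg V))) (Q1 L M o) a') k)⁻¹)
      (Cpert (kappaBs o d a α β (a * (epsR o d α * (2 + epsR o d α) * Cst d a)) (kappa4F d a a' α β))
        (2 * d * Cst d a) (CJ d a)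
        (C2Bs o d L a α β C
          (a * C2gram (Cst d a) 1 (epsR o d α) (2 * d * Cst d a) (CJ d a) (Cst d a) (CdeltaR o d a α (theta0 d α (betaNE3 o C))))
          (C4F o d L a a' α β C)) 0 1) ((L : ℝ)⁻¹) :=
  balaban_final_rate_of_regular L M a ha hL hd hreg hC
    (localRate_regClass_of_minActReadings L M hC hθ0 hθL hNE3 hV) ha' hαη hβη hη

/-- **ROOT B AT `t = 1` FOR EVERY ADMISSIBLE DATUM, DISPLAYING NODE U1b's FULL SHAPE `NE3Shape` ON NE3's CARRIER** (action half = NE3-(A), local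
half = ROOT B's `hNE3` for this reading; both OPEN, displayed) with a rate `θ ≤ L⁻¹`. [folklore] -/
theorem balaban_final_rate_of_ne3Shape (hL : 2 ≤ L) (hd : 1 ≤ d) {C θ : ℝ} (hC : 0 ≤ C) (hθL : θ ≤ (L : ℝ)⁻¹)
    (hNE3 : NE3Shape (minActReadings d 𝒞 L N dom (ne2Loc L M fun V => liftR L M (Rg V))) C θ)
    {V : B7Prop1Explicit.Site d → Fin d → (Matrix o o ℂ)ˣ} (hV : V ∈ dom)
    {α β : ℝ} (hreg : RegularTransporters L M (liftR L M (Rg V)) α β) {a' : ℝ} (ha' : 0 < a')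
    {η : ℝ} (hαη : α ≤ η) (hβη : β ≤ η) (hη : η ≤ etaStar o d a a') :
    TowerLimitRate (fun k => Qlev L M k ⊗ₖ (1 : Matrix o o ℂ)) ((L : ℝ) ^ d)
      (fun k => (calDalev L M a ha k ⊗ₖ (1 : Matrix o o ℂ)
        + balabanPert L M a (liftR L M (Rg V)) (gaugeSlot L M (Rg V) (QuT L M o (siteT L M (Rg V))) (Q1 L M o) a') k)⁻¹)
      (Cpert (kappaBs o d a α β (a * (epsR o d α * (2 + epsR o d α) * Cst d a)) (kappa4F d a a' α β))
        (2 * d * Cst d a) (CJ d a)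
        (C2Bs o d L a α β C
          (a * C2gram (Cst d a) 1 (epsR o d α) (2 * d * Cst d a) (CJ d a) (Cst d a) (CdeltaR o d a α (theta0 d α (betaNE3 o C))))
          (C4F o d L a a' α β C)) 0 1) ((L : ℝ)⁻¹) :=
  balaban_final_rate_of_minActReadings L M a ha hL hd hC hNE3.rate_nonneg hθL hNE3.pointwise hV hreg ha' hαη hβη hη

/-- the same at NE3-(A)'s rate `θ = (L²)⁻¹` (`(L²)⁻¹ ≤ L⁻¹` for `L ≥ 1`). [folklore] -/
theorem balaban_final_rate_of_ne3Shape_sq (hL : 2 ≤ L) (hd : 1 ≤ d) {C : ℝ} (hC : 0 ≤ C)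
    (hNE3 : NE3Shape (minActReadings d 𝒞 L N dom (ne2Loc L M fun V => liftR L M (Rg V))) C (((L : ℝ) ^ 2)⁻¹))
    {V : B7Prop1Explicit.Site d → Fin d → (Matrix o o ℂ)ˣ} (hV : V ∈ dom)
    {α β : ℝ} (hreg : RegularTransporters L M (liftR L M (Rg V)) α β) {a' : ℝ} (ha' : 0 < a')
    {η : ℝ} (hαη : α ≤ η) (hβη : β ≤ η) (hη : η ≤ etaStar o d a a') :
    TowerLimitRate (fun k => Qlev L M k ⊗ₖ (1 : Matrix o o ℂ)) ((L : ℝ) ^ d)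
      (fun k => (calDalev L M a ha k ⊗ₖ (1 : Matrix o o ℂ)
        + balabanPert L M a (liftR L M (Rg V)) (gaugeSlot L M (Rg V) (QuT L M o (siteT L M (Rg V))) (Q1 L M o) a') k)⁻¹)
      (Cpert (kappaBs o d a α β (a * (epsR o d α * (2 + epsR o d α) * Cst d a)) (kappa4F d a a' α β))
        (2 * d * Cst d a) (CJ d a)
        (C2Bs o d L a α β C
          (a * C2gram (Cst d a) 1 (epsR o d α) (2 * d * Cst d a) (CJ d a) (Cst d a) (CdeltaR o d a α (theta0 d α (betaNE3 o C))))
          (C4F o d L a a' α β C)) 0 1) ((L : ℝ)⁻¹) := by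
  have hL1 : (1 : ℝ) ≤ L := by exact_mod_cast (le_trans (by norm_num) hL : 1 ≤ L)
  have hsq : (L : ℝ) ≤ (L : ℝ) ^ 2 := by nlinarith
  have hθL : ((L : ℝ) ^ 2)⁻¹ ≤ (L : ℝ)⁻¹ := inv_anti₀ (by positivity) hsq
  exact balaban_final_rate_of_ne3Shape L M a ha hL hd hC hθL hNE3 hV hreg ha' hαη hβη hη

end RootB

/-! ## §3 Junction with the NE3 swarm's leaf index -/

section Junction

variable {𝒞 : ℕ → Set (B7Prop1Explicit.Site d → Fin d → (Matrix o o ℂ)ˣ)} {N : ℕ}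
  {dom : Set (B7Prop1Explicit.Site d → Fin d → (Matrix o o ℂ)ˣ)}
  {Rt : (B7Prop1Explicit.Site d → Fin d → (Matrix o o ℂ)ˣ) → ((k : ℕ) → Fin d → (idx L M k → Matrix o o ℂ))}

omit [NeZero L] hM in
/-- **NODE U1b's FULL SHAPE ON NE3's CARRIER WITH THE NE2 READING = the NE3 swarm's ROOT-A ∧ ROOT B's `hNE3` for every datum** (at the wall's
constant `wallConstNA(d,L)·(g + b³)/L²` and NE3-(A)'s rate `(L²)⁻¹`): `NE3.LeafIndex.ne3Shape_minAct_iff` (typer t4-ne3-formalise-typer) and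
`localRate_minActReadings_iff` BY NAME.  Both halves OPEN; nothing of node NE3 is proved here. [folklore] -/
theorem ne3Shape_iff_rootA_and_rootB (b g : ℝ) :
    NE3Shape (minActReadings d 𝒞 L N dom (ne2Loc L M Rt)) (wallConstNA d L * (g + b ^ 3) / (L : ℝ) ^ 2) (((L : ℝ) ^ 2)⁻¹) ↔
      (0 ≤ ((L : ℝ) ^ 2)⁻¹ ∧ ((L : ℝ) ^ 2)⁻¹ < 1) ∧ NE3.LeafIndex.RootA d 𝒞 L N b g dom (ne2Loc L M Rt)
        ∧ ∀ V ∈ dom, LocalRate (bgReadings L M (regClass L M (Rt V))) (wallConstNA d L * (g + b ^ 3) / (L : ℝ) ^ 2) (((L : ℝ) ^ 2)⁻¹) := by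
  rw [NE3.LeafIndex.ne3Shape_minAct_iff, localRate_minActReadings_iff L M]

end Junction

/-! ## §4 Non-vacuity of the displayed binder on NE3's carrier -/

section Flat

variable {𝒞 : ℕ → Set (B7Prop1Explicit.Site d → Fin d → (Matrix o o ℂ)ˣ)} {N : ℕ}
  {dom : Set (B7Prop1Explicit.Site d → Fin d → (Matrix o o ℂ)ˣ)}

omit [NeZero L] hM in
/-- **THE ADAPTER's HYPOTHESIS IS INHABITED**: for the flat family `Rg ≡ 1` (every datum), node U1b's `LocalRate` on NE3's carrier with the NE2 reading
holds for all `C, θ ≥ 0` (leaf-03's `localRate_flat` through `localRate_minActReadings_iff`).  Says nothing about non-flat data; NE3 NOT proved. [folklore] -/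
theorem localRate_minActReadings_flat {C θ : ℝ} (hC : 0 ≤ C) (hθ : 0 ≤ θ) :
    LocalRate (minActReadings d 𝒞 L N dom (ne2Loc L M fun _ => liftR L M (oneR L M (o := o)))) C θ :=
  (localRate_minActReadings_iff L M).2 fun _ _ => NE2BalabanFlatWitness.localRate_flat L M hC hθ

end Flat

end Summit.QuantumFields.BalabanUV.T4Continuum.NE2BalabanFromNE3

end
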